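import Summits.QuantumFields.BalabanUV.T4Continuum.Spine.NE1p.B7AveragingIterateCommutator

/-!
# T⁴ programme, spine estimate NE1′ (node O3b/H2) — THE ITERATE (43) AT SECOND ORDER, STRUCTURE: at every level the
# quadratic term of `log Ū^{j}(e^{tA})` lies in the `ℂ`-span of the pairwise commutators `[A(b), A(b′)]` of the field's values

Cell `pub-balaban-gaps` (YM blitz Y1, track G2), seat `ne1` gen 10 (prover-pub-balaban-gaps-ne1-g10-0); record `HOME/ne/NE1.md`
v10 §6 (xviii).  ADDITIVE — imports this seat's `B7AveragingIterateCommutator` (gen 10: local data, propagation, the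
level-`(j+1)` formula) and through it the lineages' `B7Prop1Explicit` ∕ `B7Prop2Explicit` ∕ `B7Prop3Flat` BY NAME; 0 def.

WHAT THIS FILE PROVES ([folklore] bookkeeping; 0 sorry).  Fix any `ℂ`-submodule `S` of the algebra.
* §1 COMMUTATOR CLOSURE.  If all `[B(b), B(b′)] ∈ S` then so are the commutators of signed letters (`comm_stepA_stepA_mem`),
  of a letter with a path sum (`comm_stepA_asum_mem`), of two path sums (`comm_asum_asum_mem`), of the first-order exponent
  `X̂_c(B)` with a path sum (`comm_Xhat_asum_mem`), of two first-order terms `T_c(B), T_{c′}(B)` (`comm_Tside_Tside_mem`),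
  and — by induction over (43) — of any two values of every LINEAR ITERATE `(rescale ∘ T)^{j}(A)` (`comm_linIterate_mem`).
* §2 CURVATURE CLOSURE.  For a configuration curve through `1` with local data and velocity field `A` (file 10's shape):
  bond curvatures in `S` and `[A(b), A(b′)] ∈ S` ⇒ letter, WORD (`iteratedDeriv_two_mlog_hol_curve_mem`) and AVERAGED-BOND
  (`iteratedDeriv_two_mlog_bavg_curve_mem`) curvatures in `S`; hence, with file 10's propagation of the data and §1,
  **`iteratedDeriv_two_mlog_avgIter_mem`: the curvatures of EVERY level of (43) stay in `S`.**
* §3 THE RAY `U = e^{tA}`.  Its bond curves `e^{tA(b)}` have zero `log`-curvature, so with `S :=` the span of the pairwise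
  commutators of the values of `A`: **`iteratedDeriv_two_mlog_avgIter_expCfg_mem_span` — for EVERY bond field `A` (no
  commutativity, no radius), every `L ≥ 1`, every level `j`, every bond: `d²/dt²|₀ log Ū^{j}(e^{tA})(b) ∈ span_ℂ{A(b₁)A(b₂) −
  A(b₂)A(b₁)}`** — «every term a commutator» for ALL levels of Bałaban's iterated averaging (43) with its contour system (gen 9
  file 8 = level 1); and the ABELIAN COROLLARY **`iteratedDeriv_two_mlog_avgIter_expCfg_of_commute`: pairwise commuting values
  ⇒ NO DIAGONAL CURVATURE AT ANY LEVEL** (gen 8's `avgIter_expCfg` gave this only while all loop sums stay inside the radius of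
  (21); at `t → 0` nothing is needed).
What it does NOT do: sizes (how large the coefficients in that span are — the ESTIMATE), backgrounds `U₀ ≠ 1`, RG densities.

HONEST FRAMING.  [folklore] bookkeeping; nothing of Bałaban's asserted; NE1′ NOT proved; spine 0∕9; (B) 0∕13; binders 0∕6; one
fixed finite T⁴ — NOT ℝ⁴, NOT infinite volume, NOT a mass gap, NOT Clay.
-/

noncomputable section

open scoped Topology
open NormedSpace Filter

namespace Summit.QuantumFields.BalabanUV.T4Continuum.NE1p.B7AveragingCommutator

open Literature.MathematicalPhysics.QuantumFieldTheory.Balaban1983to89.MatrixLog (mlog)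
open Literature.MathematicalPhysics.QuantumFieldTheory.Balaban1983to89.B7Prop1Explicit
open Literature.MathematicalPhysics.QuantumFieldTheory.Balaban1983to89.B7Prop2Explicit (rescale rescale_apply avgIter)
open Literature.MathematicalPhysics.QuantumFieldTheory.Balaban1983to89.B7Prop3Flat (expCfg)
open Literature.MathematicalPhysics.QuantumFieldTheory.Balaban1983to89.B7Prop3GeneralRotated (expCfg_zero)

variable {𝔸 : Type*} [NormedRing 𝔸] [NormedAlgebra ℂ 𝔸] [CompleteSpace 𝔸]

/-! ## §1 Commutator closure: letters, path sums, `X̂`, `T`, linear iterates -/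

section Comm

variable {d : ℕ} (S : Submodule ℂ 𝔸) {B : Site d → Fin d → 𝔸}
  (hB : ∀ (x : Site d) (κ : Fin d) (y : Site d) (μ : Fin d), B x κ * B y μ - B y μ * B x κ ∈ S)

omit [CompleteSpace 𝔸] in
/-- An `ℝ`-weighted sum of elements whose commutators with `b` lie in `S` has its commutator with `b` in `S` (bilinearity; the
weights `L^{−d}` of (42) are real). [folklore] -/
theorem comm_sum_smul_left_mem {ι : Type*} (s : Finset ι) (c : ι → ℝ) (a : ι → 𝔸) (b : 𝔸)
    (h : ∀ i ∈ s, a i * b - b * a i ∈ S) :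
    (∑ i ∈ s, c i • a i) * b - b * (∑ i ∈ s, c i • a i) ∈ S := by
  rw [Finset.sum_mul, Finset.mul_sum, ← Finset.sum_sub_distrib]
  refine Submodule.sum_mem S fun i hi => ?_
  rw [smul_mul_assoc, mul_smul_comm, ← smul_sub]
  exact S.smul_of_tower_mem (c i) (h i hi)

include hB

omit [CompleteSpace 𝔸] in
/-- Signed letters: `[stepA B b, stepA B b′] ∈ S` (signs pull out). [folklore] -/
theorem comm_stepA_stepA_mem (x : Site d) (l : Letter d) (y : Site d) (l' : Letter d) :
    stepA B x l * stepA B y l' - stepA B y l' * stepA B x l ∈ S := by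
  have n1 : ∀ X Y : 𝔸, X * Y - Y * X ∈ S → -X * Y - Y * -X ∈ S := fun X Y h => by
    convert S.neg_mem h using 1; noncomm_ring
  have n2 : ∀ X Y : 𝔸, X * Y - Y * X ∈ S → X * -Y - -Y * X ∈ S := fun X Y h => by
    convert S.neg_mem h using 1; noncomm_ring
  have n3 : ∀ X Y : 𝔸, X * Y - Y * X ∈ S → -X * -Y - -Y * -X ∈ S := fun X Y h => by
    convert h using 1; noncomm_ring
  obtain ⟨κ, b⟩ := l
  obtain ⟨μ, b'⟩ := l'
  cases b <;> cases b' <;> simp only [stepA_true, stepA_false]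
  · exact n3 _ _ (hB _ _ _ _)
  · exact n1 _ _ (hB _ _ _ _)
  · exact n2 _ _ (hB _ _ _ _)
  · exact hB _ _ _ _

omit [CompleteSpace 𝔸] in
/-- A letter against a path sum: `[stepA B b, B(Γ)] ∈ S`. [folklore] -/
theorem comm_stepA_asum_mem (x : Site d) (l : Letter d) :
    ∀ (w : List (Letter d)) (y : Site d), stepA B x l * asum B y w - asum B y w * stepA B x l ∈ S
  | [], y => by simp
  | l' :: w, y => by
    rw [asum_cons]
    have e : stepA B x l * (stepA B y l' + asum B (y + l'.vec) w) - (stepA B y l' + asum B (y + l'.vec) w) * stepA B x l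
        = (stepA B x l * stepA B y l' - stepA B y l' * stepA B x l)
          + (stepA B x l * asum B (y + l'.vec) w - asum B (y + l'.vec) w * stepA B x l) := by noncomm_ring
    rw [e]
    exact S.add_mem (comm_stepA_stepA_mem S hB x l y l') (comm_stepA_asum_mem x l w (y + l'.vec))

omit [CompleteSpace 𝔸] in
/-- Two path sums: `[B(Γ), B(Γ′)] ∈ S`. [folklore] -/
theorem comm_asum_asum_mem :
    ∀ (w₁ : List (Letter d)) (x : Site d) (w₂ : List (Letter d)) (y : Site d),
      asum B x w₁ * asum B y w₂ - asum B y w₂ * asum B x w₁ ∈ S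
  | [], x, w₂, y => by simp
  | l :: w₁, x, w₂, y => by
    rw [asum_cons]
    have e : (stepA B x l + asum B (x + l.vec) w₁) * asum B y w₂ - asum B y w₂ * (stepA B x l + asum B (x + l.vec) w₁)
        = (stepA B x l * asum B y w₂ - asum B y w₂ * stepA B x l)
          + (asum B (x + l.vec) w₁ * asum B y w₂ - asum B y w₂ * asum B (x + l.vec) w₁) := by noncomm_ring
    rw [e]
    exact S.add_mem (comm_stepA_asum_mem S hB x l w₂ y) (comm_asum_asum_mem w₁ (x + l.vec) w₂ y)

omit [CompleteSpace 𝔸] in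
/-- The first-order exponent of (42) against a path sum: `[X̂_c(B), B(Γ)] ∈ S`. [cite: Balaban1985Averaging, p.25 (displays before (47))] -/
theorem comm_Xhat_asum_mem (L : ℕ) (q : Site d) (κ : Fin d) (y : Site d) (w : List (Letter d)) :
    Xhat L B q κ * asum B y w - asum B y w * Xhat L B q κ ∈ S := by
  unfold Xhat
  exact comm_sum_smul_left_mem S _ _ _ _ fun r _ => comm_asum_asum_mem S hB _ _ _ _

omit [CompleteSpace 𝔸] in
/-- Two first-order terms `T_c(B) = L·B̄_c` (14): `[T_c(B), T_{c′}(B)] ∈ S` — `T` preserves the commutator module. [cite: Balaban1985Averaging, (14) p.19, (47) p.25] -/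
theorem comm_Tside_Tside_mem (L : ℕ) (q : Site d) (κ : Fin d) (q' : Site d) (κ' : Fin d) :
    Tside L B q κ * Tside L B q' κ' - Tside L B q' κ' * Tside L B q κ ∈ S := by
  unfold Tside
  refine comm_sum_smul_left_mem S _ _ _ _ fun r _ => ?_
  have h := comm_sum_smul_left_mem S (Finset.univ : Finset (Fin d → Fin L)) (fun _ => ((L : ℝ) ^ d)⁻¹)
    (fun r' => asum B q' (gammaWord L κ' (boxVec L r'))) (asum B q (gammaWord L κ (boxVec L r)))
    fun r' _ => comm_asum_asum_mem S hB _ _ _ _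
  simpa [neg_sub] using S.neg_mem h

omit hB [CompleteSpace 𝔸] in
/-- **EVERY LINEAR ITERATE OF (43) PRESERVES THE COMMUTATOR MODULE**: if all `[A(b), A(b′)] ∈ S` then, for every `j`, all
`[A_j(b), A_j(b′)] ∈ S` with `A_j = (rescale ∘ T)^{j}(A)` (each `A_j(b)` is a real-linear combination of values of `A`).
[cite: Balaban1985Averaging, (14) p.19, (43) p.24] -/
theorem comm_linIterate_mem (L : ℕ) {A : Site d → Fin d → 𝔸}
    (hA : ∀ (x : Site d) (κ : Fin d) (y : Site d) (μ : Fin d), A x κ * A y μ - A y μ * A x κ ∈ S) :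
    ∀ (j : ℕ) (x : Site d) (κ : Fin d) (y : Site d) (μ : Fin d),
      ((fun B => rescale L (Tside L B))^[j] A) x κ * ((fun B => rescale L (Tside L B))^[j] A) y μ
        - ((fun B => rescale L (Tside L B))^[j] A) y μ * ((fun B => rescale L (Tside L B))^[j] A) x κ ∈ S
  | 0 => hA
  | j + 1 => by
    intro x κ y μ
    rw [Function.iterate_succ_apply']
    exact comm_Tside_Tside_mem S (comm_linIterate_mem L hA j) L _ _ _ _

end Comm

/-! ## §2 Curvature closure along a curve with local data; every level of (43) -/

section Mem

variable {d : ℕ} (S : Submodule ℂ 𝔸) {V : ℂ → Site d → Fin d → 𝔸ˣ} {A : Site d → Fin d → 𝔸} (h0 : V 0 = 1)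
  (hV : ∀ (y : Site d) (μ : Fin d), ∃ v₁ : ℂ → 𝔸, ∃ w : 𝔸,
    (∀ᶠ t in 𝓝 (0 : ℂ), HasDerivAt (fun u : ℂ => ((V u y μ : 𝔸ˣ) : 𝔸)) (v₁ t) t) ∧ HasDerivAt v₁ w 0 ∧ v₁ 0 = A y μ)
  (hK : ∀ (y : Site d) (μ : Fin d), iteratedDeriv 2 (fun t : ℂ => mlog ((V t y μ : 𝔸ˣ) : 𝔸)) 0 ∈ S)
  (hA : ∀ (x : Site d) (κ : Fin d) (y : Site d) (μ : Fin d), A x κ * A y μ - A y μ * A x κ ∈ S)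

include h0 hV hK in
/-- Letter curvatures stay in `S` (`κ(−b) = −κ(b)`). [cite: Balaban1985Averaging, (9) p.18] -/
theorem iteratedDeriv_two_mlog_stepHol_mem (x : Site d) (l : Letter d) :
    iteratedDeriv 2 (fun t : ℂ => mlog ((stepHol (V t) x l : 𝔸ˣ) : 𝔸)) 0 ∈ S := by
  obtain ⟨μ, b⟩ := l
  cases b
  · obtain ⟨v₁, w, hv, hv₁, -⟩ := hV (x - e μ) μ
    rw [iteratedDeriv_two_mlog_stepHol_false_loc h0 x μ hv hv₁]; exact S.neg_mem (hK _ _)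
  · rw [iteratedDeriv_two_mlog_stepHol_true]; exact hK _ _

include h0 hV hK hA

/-- **WORD curvatures stay in `S`** (word recursion: letter + tail + `[stepA A b, A(Γ)]`). [cite: Balaban1985Averaging, (9) p.18, (21) p.21] -/
theorem iteratedDeriv_two_mlog_hol_curve_mem :
    ∀ (w : List (Letter d)) (x : Site d), iteratedDeriv 2 (fun t : ℂ => mlog ((hol (V t) x w : 𝔸ˣ) : 𝔸)) 0 ∈ S
  | [], x => by rw [iteratedDeriv_two_mlog_hol_curve_nil]; exact S.zero_mem
  | l :: w, x => by
    rw [iteratedDeriv_two_mlog_hol_curve_cons_loc h0 hV]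
    exact S.add_mem (S.add_mem (iteratedDeriv_two_mlog_stepHol_mem S h0 hV hK x l)
      (iteratedDeriv_two_mlog_hol_curve_mem w (x + l.vec))) (comm_stepA_asum_mem S hA x l w (x + l.vec))

/-- **AVERAGED-BOND curvatures stay in `S`**: `d²/dt²|₀ log Ū_c(V(t)) ∈ S` (file 10's one-step formula: real-weighted word
curvatures + `[X̂_c(A), A(Γ_c)]`). [cite: Balaban1985Averaging, (42) p.23, (15) p.19] -/
theorem iteratedDeriv_two_mlog_bavg_curve_mem (L : ℕ) (q : Site d) (κ : Fin d) :
    iteratedDeriv 2 (fun t : ℂ => mlog ((bavg L (V t) q κ : 𝔸ˣ) : 𝔸)) 0 ∈ S := by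
  rw [iteratedDeriv_two_mlog_bavg_curve_loc h0 hV L q κ]
  refine S.add_mem (S.add_mem (Submodule.sum_mem S fun r _ => S.smul_of_tower_mem _ ?_) ?_) ?_
  · exact iteratedDeriv_two_mlog_hol_curve_mem S h0 hV hK hA _ _
  · exact iteratedDeriv_two_mlog_hol_curve_mem S h0 hV hK hA _ _
  · exact comm_Xhat_asum_mem S hA L q κ q _

/-- **EVERY LEVEL OF (43)**: if the bond curvatures of `V(t)` and the commutators of its velocity field lie in `S`, then so does
`d²/dt²|₀ log Ū^{j}(V(t))(b)` for every `L ≥ 1`, every `j`, every bond (file 10's data propagation `exists_derivData_avgIter` +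
§1's `comm_linIterate_mem` feed the induction). [cite: Balaban1985Averaging, (43) p.24] -/
theorem iteratedDeriv_two_mlog_avgIter_mem (L : ℕ) (hL : 1 ≤ L) :
    ∀ (j : ℕ) (z : Site d) (κ : Fin d),
      iteratedDeriv 2 (fun t : ℂ => mlog ((avgIter L (V t) j z κ : 𝔸ˣ) : 𝔸)) 0 ∈ S
  | 0 => hK
  | j + 1 => by
    intro z κ
    have e : (fun t : ℂ => mlog ((avgIter L (V t) (j + 1) z κ : 𝔸ˣ) : 𝔸))
        = fun t : ℂ => mlog ((bavg L (avgIter L (V t) j) ((L : ℤ) • z) κ : 𝔸ˣ) : 𝔸) := rfl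
    rw [e]
    exact iteratedDeriv_two_mlog_bavg_curve_mem S (V := fun t : ℂ => avgIter L (V t) j) (avgIter_curve_zero' L h0 j)
      (exists_derivData_avgIter L hL h0 hV j) (iteratedDeriv_two_mlog_avgIter_mem L hL j) (comm_linIterate_mem S L hA j)
      L ((L : ℤ) • z) κ

end Mem

/-! ## §3 The ray `U = e^{tA}`: every level's quadratic term is in the span of the pairwise commutators of `A` -/

section Ray

variable {d : ℕ}

/-- The bond curves of `e^{tA}` have local data with velocity field `A` (`(e^{tX})′ = Xe^{tX}`, `(Xe^{tX})′(0) = X²`).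
[folklore] -/
theorem exists_derivData_expCfg_smul (A : Site d → Fin d → 𝔸) (y : Site d) (μ : Fin d) :
    ∃ v₁ : ℂ → 𝔸, ∃ w : 𝔸, (∀ᶠ t in 𝓝 (0 : ℂ), HasDerivAt (fun u : ℂ => ((expCfg (u • A) y μ : 𝔸ˣ) : 𝔸)) (v₁ t) t)
      ∧ HasDerivAt v₁ w 0 ∧ v₁ 0 = A y μ := by
  refine ⟨fun t => A y μ * exp (t • A y μ), A y μ * A y μ, Filter.Eventually.of_forall fun t => ?_, ?_, by simp⟩
  · have e : (fun u : ℂ => ((expCfg (u • A) y μ : 𝔸ˣ) : 𝔸)) = fun u : ℂ => exp (u • A y μ) := by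
      funext u; rfl
    rw [e]; exact hasDerivAt_exp_smul_const' (A y μ) t
  · simpa using (hasDerivAt_exp_smul_const' (A y μ) (0 : ℂ)).const_mul (A y μ)

/-- The bond curves of `e^{tA}` have NO `log`-curvature: `d²/dt²|₀ log e^{tA(b)} = 0` (file 7's one-parameter lemma).
[cite: Balaban1985Averaging, (21) p.21] -/
theorem iteratedDeriv_two_mlog_expCfg_smul (A : Site d → Fin d → 𝔸) (y : Site d) (μ : Fin d) :
    iteratedDeriv 2 (fun t : ℂ => mlog ((expCfg (t • A) y μ : 𝔸ˣ) : 𝔸)) 0 = 0 := by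
  have e : (fun t : ℂ => mlog ((expCfg (t • A) y μ : 𝔸ˣ) : 𝔸)) = fun t : ℂ => mlog (exp (t • A y μ)) := by
    funext t; rfl
  rw [e]; exact iteratedDeriv_two_mlog_exp_smul_zero (A y μ)

/-- **THE QUADRATIC TERM OF EVERY LEVEL OF THE ITERATE (43) IS IN THE SPAN OF THE PAIRWISE COMMUTATORS OF THE FIELD**: for
every bond field `A` on `ℤᵈ` with values in a complete normed `ℂ`-algebra (NO commutativity, NO radius hypothesis), every
`L ≥ 1`, every level `j` and every bond `(z, κ)` of the level-`j` lattice,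
`d²/dt²|₀ log Ū^{j}(e^{tA})(z, κ) ∈ span_ℂ { A(b₁)A(b₂) − A(b₂)A(b₁) : b₁, b₂ bonds }` — «every term a commutator» for ALL
levels of Bałaban's iterated averaging with its contour system (gen 9's file 8 = the explicit level-1 formula).
[cite: Balaban1985Averaging, (15) p.19, p.20, (42)–(43) pp.23–24] -/
theorem iteratedDeriv_two_mlog_avgIter_expCfg_mem_span (L : ℕ) (hL : 1 ≤ L) (A : Site d → Fin d → 𝔸) (j : ℕ)
    (z : Site d) (κ : Fin d) :
    iteratedDeriv 2 (fun t : ℂ => mlog ((avgIter L (expCfg (t • A)) j z κ : 𝔸ˣ) : 𝔸)) 0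
      ∈ Submodule.span ℂ {c : 𝔸 | ∃ (x : Site d) (κ' : Fin d) (y : Site d) (μ : Fin d),
          c = A x κ' * A y μ - A y μ * A x κ'} :=
  iteratedDeriv_two_mlog_avgIter_mem
    (Submodule.span ℂ {c : 𝔸 | ∃ (x : Site d) (κ' : Fin d) (y : Site d) (μ : Fin d), c = A x κ' * A y μ - A y μ * A x κ'})
    (V := fun t : ℂ => expCfg (t • A)) (by simp only [zero_smul, expCfg_zero])
    (exists_derivData_expCfg_smul A) (fun y μ => by rw [iteratedDeriv_two_mlog_expCfg_smul]; exact Submodule.zero_mem _)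
    (fun x κ' y μ => Submodule.subset_span (by exact ⟨x, κ', y, μ, rfl⟩)) L hL j z κ

/-- **ABELIAN COROLLARY — NO DIAGONAL CURVATURE AT ANY LEVEL OF (43)**: if the values of `A` pairwise commute then
`d²/dt²|₀ log Ū^{j}(e^{tA})(b) = 0` for every `L ≥ 1`, every level and every bond (gen 8's `avgIter_expCfg` gave
`Ū^{j}(e^{tA}) = e^{t(rescale∘T)^{j}(A)}` only while all loop sums stay inside the radius of (21); the statement at `t → 0`
needs nothing). [cite: Balaban1985Averaging, (15) p.19, (43) p.24] -/
theorem iteratedDeriv_two_mlog_avgIter_expCfg_of_commute (L : ℕ) (hL : 1 ≤ L) {A : Site d → Fin d → 𝔸}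
    (hA : ∀ (x : Site d) (κ : Fin d) (y : Site d) (μ : Fin d), Commute (A x κ) (A y μ)) (j : ℕ) (z : Site d)
    (κ : Fin d) :
    iteratedDeriv 2 (fun t : ℂ => mlog ((avgIter L (expCfg (t • A)) j z κ : 𝔸ˣ) : 𝔸)) 0 = 0 := by
  have h := iteratedDeriv_two_mlog_avgIter_expCfg_mem_span L hL A j z κ
  have hbot : Submodule.span ℂ {c : 𝔸 | ∃ (x : Site d) (κ' : Fin d) (y : Site d) (μ : Fin d),
      c = A x κ' * A y μ - A y μ * A x κ'} = ⊥ := by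
    rw [Submodule.span_eq_bot]
    rintro c ⟨x, κ', y, μ, rfl⟩
    rw [(hA x κ' y μ).eq, sub_self]
  rw [hbot, Submodule.mem_bot] at h
  exact h

end Ray

end Summit.QuantumFields.BalabanUV.T4Continuum.NE1p.B7AveragingCommutator

end
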